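import Mathlib
import Summits.AtomisticToContinuum.Crystallization.Theorems.ThreeConeCertificateExactCertificateTransfer1DMaxGap
import Summits.AtomisticToContinuum.Crystallization.Theorems.ThreeConeCertificateExactCertificateTransfer1DBlockMatching

/-!
# `ExactCertificate` (stmt-AtomisticToContinuum-11959), line `closure-makes-nogap-exact`,
# Transfer skeleton IV (`Cruxes.ExactCertificate.Transfer1D.SlackRigidity1D`): stub `stub_contract`

Support file for the crux `ThreeConeCertificate.ExactCertificate` (crux 11959), line
`closure-makes-nogap-exact`, TRANSFER skeleton IV `SlackRigidity1D` (slack rigidity of the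
Lennard-Jones CHAIN: the route decl `SlackRigidity` with `3 ↦ 1`).  Nothing in this file closes
the 3-D crux; it proves the registered stub `stub_contract` (STRETCH SURGERY, step 2 of the
mechanism of skeleton IV).

With `V = lennardJones`, `y : ℕ → ℝ` the sorted positions of `n` particles on a line, all of whose
nearest-neighbour gaps are `≥ 3/4`, the CONTRACTED configuration
`z k := y 0 + Σ_{l<k} min (y (l+1) - y l) 1` replaces every gap `> 1` by exactly `1` and keeps the
others.  Its gaps are `min (gap, 1) ∈ [3/4, 1]`, it is strictly increasing on `range n`, and its
LINE ENERGY `∑ i < n, ∑ i < j < n, V (|z j - z i|)` is not larger than that of `y`, TERMWISE: for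
`p < q < n` the distance `z q - z p = Σ_{p ≤ l < q} min (gap_l, 1)` is at most
`y q - y p = Σ_{p ≤ l < q} gap_l` (telescoping, the imported `blockMatching_telescope`); if every
gap in between is `≤ 1` the two distances agree, otherwise one summand equals `1` and the others
are `≥ 0`, so `1 ≤ z q - z p ≤ y q - y p`, where `V` is increasing (the imported
`NearFarGlueRNegative.lennardJones_mono_of_one_le`).  This is the non-strict, all-gaps-at-once
analogue of `maxGap_termwise` (`…Transfer1DMaxGap`).  Helper lemmas are prefixed
`slackContract_`; all `[folklore]`.
-/

noncomputable section

namespace Summit.AtomisticToContinuum.Crystallization.Theorems.ThreeConeCertificateExactCertificate.Transfer1D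

open Literature.MathematicalPhysics.StatisticalMechanics
open Summit.AtomisticToContinuum.Crystallization.Theorems.NearFarGlueRNegative
  (lennardJones_mono_of_one_le)
open scoped BigOperators

/-! ## Pair distances of the contracted configuration -/

/-- Pair distances of a configuration `z` whose gaps are `min (gap of y, 1)`: telescoping,
`z (p + k) - z p = Σ_{l<k} min (y (p+l+1) - y (p+l)) 1`. [folklore] -/
theorem slackContract_dist (y z : ℕ → ℝ)
    (hz : ∀ i : ℕ, z (i + 1) - z i = min (y (i + 1) - y i) 1) (p k : ℕ) :
    z (p + k) - z p = ∑ l ∈ Finset.range k, min (y (p + l + 1) - y (p + l)) 1 := by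
  rw [blockMatching_telescope z p k]
  exact Finset.sum_congr rfl fun l _ => hz (p + l)

/-- The contracted pair distance is at most the original one (`min (gap, 1) ≤ gap` termwise along
the two telescopes). [folklore] -/
theorem slackContract_dist_le (y z : ℕ → ℝ)
    (hz : ∀ i : ℕ, z (i + 1) - z i = min (y (i + 1) - y i) 1) (p k : ℕ) :
    z (p + k) - z p ≤ y (p + k) - y p := by
  rw [slackContract_dist y z hz, blockMatching_telescope y p k]
  exact Finset.sum_le_sum fun l _ => min_le_left _ _

/-- If the `k` gaps of `y` starting at `p` are all `≥ 3/4`, the contracted pair distance is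
`≥ (3/4) k` (each contracted gap is `min (gap, 1) ≥ 3/4`). [folklore] -/
theorem slackContract_dist_lower (y z : ℕ → ℝ)
    (hz : ∀ i : ℕ, z (i + 1) - z i = min (y (i + 1) - y i) 1) (p k : ℕ)
    (h : ∀ l : ℕ, l < k → 3 / 4 ≤ y (p + l + 1) - y (p + l)) :
    3 / 4 * (k : ℝ) ≤ z (p + k) - z p :=
  blockMatching_lower z p k fun l hl => by
    rw [hz (p + l)]
    exact le_min (h l hl) (by norm_num)

/-- Dichotomy: if the `k` gaps of `y` starting at `p` are all `≥ 0`, then either the contracted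
pair distance equals the original one (all gaps in between are `≤ 1`), or it is `≥ 1` (some
contracted gap equals `1`, the others are `≥ 0`). [folklore] -/
theorem slackContract_dist_dichotomy (y z : ℕ → ℝ)
    (hz : ∀ i : ℕ, z (i + 1) - z i = min (y (i + 1) - y i) 1) (p k : ℕ)
    (h : ∀ l : ℕ, l < k → 0 ≤ y (p + l + 1) - y (p + l)) :
    z (p + k) - z p = y (p + k) - y p ∨ 1 ≤ z (p + k) - z p := by
  rw [slackContract_dist y z hz]
  by_cases hall : ∀ l : ℕ, l < k → y (p + l + 1) - y (p + l) ≤ 1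
  · left
    rw [blockMatching_telescope y p k]
    exact Finset.sum_congr rfl fun l hl => min_eq_left (hall l (Finset.mem_range.1 hl))
  · right
    push Not at hall
    obtain ⟨l₀, hl₀, hgt⟩ := hall
    refine le_trans (le_of_eq (min_eq_right hgt.le).symm) ?_
    exact Finset.single_le_sum (f := fun l => min (y (p + l + 1) - y (p + l)) 1)
      (fun l hl => le_min (h l (Finset.mem_range.1 hl)) zero_le_one) (Finset.mem_range.2 hl₀)

/-! ## Termwise comparison -/

/-- Termwise comparison for a configuration `y` with all gaps `≥ 3/4` on `range n` and its
contraction `z`: for `p < q < n`, `0 < z q - z p` and `V (|z q - z p|) ≤ V (|y q - y p|)` —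
either the two (positive) distances agree, or `1 ≤ z q - z p ≤ y q - y p`, where `V_LJ` is
increasing. [folklore] -/
theorem slackContract_termwise {n : ℕ} {y z : ℕ → ℝ}
    (hgap : ∀ i : ℕ, i + 1 < n → 3 / 4 ≤ y (i + 1) - y i)
    (hz : ∀ i : ℕ, z (i + 1) - z i = min (y (i + 1) - y i) 1)
    {p q : ℕ} (hpq : p < q) (hq : q < n) :
    0 < z q - z p ∧ lennardJones (|z q - z p|) ≤ lennardJones (|y q - y p|) := by
  obtain ⟨k, rfl⟩ := Nat.exists_eq_add_of_le hpq.le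
  have hk : (1 : ℝ) ≤ k := by exact_mod_cast (by omega : 1 ≤ k)
  have hl : ∀ l : ℕ, l < k → 3 / 4 ≤ y (p + l + 1) - y (p + l) :=
    fun l hl => hgap (p + l) (by omega)
  have hpos : 0 < z (p + k) - z p := by
    have hlow := slackContract_dist_lower y z hz p k hl
    linarith
  have hle : z (p + k) - z p ≤ y (p + k) - y p := slackContract_dist_le y z hz p k
  have hypos : 0 < y (p + k) - y p := lt_of_lt_of_le hpos hle
  refine ⟨hpos, ?_⟩
  rw [abs_of_pos hpos, abs_of_pos hypos]
  rcases slackContract_dist_dichotomy y z hz p k (fun l hl' => by linarith [hl l hl'])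
    with heq | h1
  · rw [heq]
  · exact lennardJones_mono_of_one_le h1 hle

/-! ## The registered stub -/

/-- STUB (C) `stub_contract` — STRETCH SURGERY: from a strictly increasing configuration with all
gaps `≥ 3/4`, replacing every gap `> 1` by exactly `1` (`z k = y 0 + Σ_{l<k} min (gap_l, 1)`)
gives a strictly increasing configuration whose gaps are `min (gap, 1)` (so it lies in the box
`[3/4, 1]`) and whose line energy is not larger: a pair distance is the sum of the gaps in
between, it weakly decreases, and if it changes at all it stays `≥ 1`, where `V_LJ` is increasing
(`NearFarGlueRNegative.lennardJones_mono_of_one_le`); sum termwise (`Finset.sum_le_sum` twice).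
[folklore] -/
theorem stub_contract : ∀ (n : ℕ) (y : ℕ → ℝ), (∀ i j : ℕ, i < j → j < n → y i < y j) →
    (∀ i : ℕ, i + 1 < n → 3 / 4 ≤ y (i + 1) - y i) →
    ∃ z : ℕ → ℝ, (∀ i j : ℕ, i < j → j < n → z i < z j) ∧
      (∀ i : ℕ, i + 1 < n → z (i + 1) - z i = min (y (i + 1) - y i) 1) ∧
      ∑ i ∈ Finset.range n, ∑ j ∈ Finset.Ico (i + 1) n, lennardJones (|z j - z i|) ≤
        ∑ i ∈ Finset.range n, ∑ j ∈ Finset.Ico (i + 1) n, lennardJones (|y j - y i|) := by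
  intro n y _ hgap
  obtain ⟨z, hzdef⟩ : ∃ z : ℕ → ℝ, ∀ k : ℕ,
      z k = y 0 + ∑ l ∈ Finset.range k, min (y (l + 1) - y l) 1 := ⟨_, fun _ => rfl⟩
  have hz : ∀ i : ℕ, z (i + 1) - z i = min (y (i + 1) - y i) 1 := fun i => by
    rw [hzdef, hzdef, Finset.sum_range_succ]
    ring
  refine ⟨z, fun i j hij hj => sub_pos.1 (slackContract_termwise hgap hz hij hj).1,
    fun i _ => hz i, ?_⟩
  refine Finset.sum_le_sum fun p _ => Finset.sum_le_sum fun q hq => ?_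
  obtain ⟨hpq, hqn⟩ := Finset.mem_Ico.1 hq
  exact (slackContract_termwise hgap hz (Nat.lt_of_succ_le hpq) hqn).2

end Summit.AtomisticToContinuum.Crystallization.Theorems.ThreeConeCertificateExactCertificate.Transfer1D

end
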